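/-
Copyright (c) 2026 the pub-hodgecm-mathlib formalisation cell (harness21).  Prover seat hodgecm-mathlib-F0P3a-p01 (g36), req620 Track A «(D-RAM) FOUR-FRAME», line LH4 (STAGE-1b,
(L-lev) producer; dealer∕pen LH4-plan (g13) WORD #62 §5: the two CLEAN-LEVEL laws `stub_law_levCleanLo∕Hi` of tier-0 ED. 6 are dealt to this lane «same (L2c)∕(L2b-κS) engines»).
THE ENGINES AT A GENERAL NEAR-1 THRESHOLD `N₀` (★ p859645 ∕ p859769 are the `N₀ := depthOfRecord` instances) and the two ED. 6 clean-level stub statements BY NAME modulo their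
two-token labelled trunks.  Bodies = ★ p859645 ∕ ★ p859650 (LH4-p12 (g7)) ∕ ★ p857128 (LH4-p04 (g3)) VERBATIM with `depthOfRecord d ↦ N₀ d`.  2026-09-04.
-/
import Summits.HodgeConjecture.HodgeConjecture.Theorems.F0P3cDyRamSqKappaSignCount2TypeZeroOfLabelledTrunk   -- ★ p859650 (LH4-p12 (g7)): one-token twin; brings ★ p857128, (C1) slot tables, glue witnesses, ★ p859535∕p859556
import Summits.HodgeConjecture.HodgeConjecture.Theorems.F0P3cDyRamLevKappaSignModelSumOfLabelledStageB    -- ★ p859645 (this seat): (L2c) at `depthOfRecord`, §1 bridge `finsum_mem_labelled_eq_finsum_mem_dualisable`; brings ★ p858900, ★ DEFS №5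
import Summits.HodgeConjecture.HodgeConjecture.Theorems.F0P3cDyRamStageOneBDerivedDefs                 -- ★ p859675 DEFS LEAF №6 (LH4-p05 (g8)): `n0DerivedOfRecord`, `amplShift`
import HarnessLib

/-!
# Crux `H413`, line LH4 «(D-RAM) FOUR-FRAME» — THE (L-lev) ENGINES AT A GENERAL THRESHOLD `N₀`, AND THE ED. 6 CLEAN-LEVEL LAWS `stub_law_levCleanLo ∕ levCleanHi` BY NAME
# MODULO THEIR TWO-TOKEN LABELLED TRUNKS

Cell `hodgecm-mathlib` (D-0151), FLOOR 0, crux item H413 = `stmt-HodgeConjecture-24833`, route `HCCMUnconditional`; squads F0∕P3c∕LH4 ∕ F0∕P3a.  THEOREMS ONLY (no `def`, no instance, no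
notation, no `sorry`, default heartbeats); lane `--supports stmt-HodgeConjecture-24833 --as helper` (count-neutral).

WHY.  ★ p859645 ((L2c)) and ★ p859769 (labelled trunk) serve the ED. 5 level stubs at `N₀ := depthOfRecord`.  Tier-0 ED. 6 (dealer WORD #62, dry c3221105, REF1 #255) adds the two
CLEAN-LEVEL laws `stub_law_levCleanLo : DyadicFence (LevKappaSignLawAtS2 shiftR omegaR n0DerivedOfRecord laLowOfRecord mcOfRecord sTOfRecord sTOfRecord σ ϖ d t)` and
`stub_law_levCleanHi : … laHighOfRecord mcOfRecord (fun d => sTOfRecord d + 1) (fun d => sTOfRecord d − 1) …` at the DERIVED threshold `n0DerivedOfRecord` (★ DEFS №6) and square level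
`mcOfRecord` — the same Prop `LevKappaSignLawAtS2` (★ DEFS №5) at other schedules.  This file re-cuts the two engines with the threshold a PARAMETER `N₀ : ℕ → ℕ` (the trunk needs only
`d ≤ N₀ d`, for ★ `exists_glue_witness`) and ties the two clean stubs BY NAME:
* §1 `levKappaSignModelSum2_at_of_labelledKappaStageB (Ω N₀ la lb A) (hBκS0)` ⟹ the `hLKSS` binder of ★ p859535 at `(shiftR, Ω, N₀, la, lb, A)` (★ p858900 labelled κ-Stage A by
  name); `dyadicFence_levKappaSignLawAtS2_at_of_labelledKappaStageB (Ω N₀ la lb kl bl)` : `DyadicFence (LevKappaSignLawAtS2 shiftR Ω N₀ la lb kl bl σ ϖ d t)` BY NAME (∘ ★ p859535);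
* §2 `kappaSignCount2_typeZero_sepTwo_at_of_labelledTrunk (N₀) (hN₀ : ∀ d, d ≤ N₀ d) (la lb A) (hA0) (hTrunk)` — ★ p857128's body at threshold `N₀` (dualisable-set form; §1 bridges to ★ p858900's set by ★ `finsum_mem_labelled_eq_finsum_mem_dualisable`); `ampl_shift_eq_zero_of_nonpos` (the `hA0` of every `(k − k•, B − b•)` amplitude);
* §3 ENDs: `dyadicFence_levKappaSignLawAtS2_at_of_labelledTrunk (N₀ hN₀ la lb kl bl) (hTrunk)` and the two ED. 6 instances
  **`dyadicFence_levKappaSignLawAtS2_cleanLow_ofRecord_of_labelledTrunk`**, **`…_cleanHigh_ofRecord_of_labelledTrunk`** (`d ≤ n0DerivedOfRecord d` by `mcOfRecord d ≥ 2d`, ★ №6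
  `mcOfRecord_le_n0DerivedOfRecord`) — AFTER THIS FILE EACH OF THE FOUR LEVEL LAW STUBS (ED. 5 lo∕hi, ED. 6 cleanLo∕cleanHi) HAS EXACTLY ONE OPEN INPUT, ITS TWO-TOKEN LABELLED TRUNK.
HONEST LABEL: helper lane, count-neutral; compositions — every `hTrunk`∕`hBκS0` is a HYPOTHESIS (binder; the clean laws' fits: `mc_check` R-U 16∕16, R-P (T5) 13∕13 ∕ (T4) 8∕8 above
`n0CleanOfRecord` — (r6) SIG-L-lev v4 §3b); pays no tier-0 row by itself; HC_CM is proved only modulo the 7 printed citations (2 remaining named inputs: hLiu418 = stmt-HodgeConjecture-24832,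
h413 = stmt-HodgeConjecture-24833) until rung 0 closes.

## References
* [Kottwitz1986BaseChangeUnits] R. E. Kottwitz, *Base change for unit elements of Hecke algebras*, Compositio Math. 60 (1986), §1 pp. 240–241.
* [Rogawski1990] J. D. Rogawski, *Automorphic Representations of Unitary Groups in Three Variables*, Ann. of Math. Stud. 123 (1990), §4.9 Prop. 4.9.1 (a)(b) p. 55, §4.10 p. 58.
* [LanglandsShelstad1987] R. P. Langlands, D. Shelstad, *On the definition of transfer factors*, Math. Ann. 278 (1987), §1.3, §3.
* [Serre1979] J.-P. Serre, *Local Fields*, GTM 67 (1979), Ch. V §3 Prop. 5, Cor. 3.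
-/

set_option autoImplicit false

noncomputable section

namespace Summit.HodgeConjecture.HodgeConjecture.Cruxes.H413.F0P3cDyRamLevKappaSignLawAtDepthOfLabelledTrunk

open Literature.NumberTheory.Automorphic Literature.NumberTheory.Automorphic.HermitianLattice
open Literature.NumberTheory.Automorphic.UnitaryLatticeTree Literature.NumberTheory.Automorphic.UnitaryThreeFourFrame
open Literature.NumberTheory.LocalFields Literature.NumberTheory.LocalFields.WildQuadraticDatum
open Summit.HodgeConjecture.HodgeConjecture.Cruxes.H413.F0P3cDyRamFourFrameLawDefs (DyadicFence)
open Summit.HodgeConjecture.HodgeConjecture.Cruxes.H413.F0P3cDyRamFourFrameLawDefsR (shiftR)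
open Summit.HodgeConjecture.HodgeConjecture.Cruxes.H413.F0P3cDyRamFourFrameLawDefsR2 (OmegaSchedule)
open Summit.HodgeConjecture.HodgeConjecture.Cruxes.H413.F0P3cDyRamFourFrameCensusDefs (LatticeInLevel)
open Summit.HodgeConjecture.HodgeConjecture.Cruxes.H413.F0P3cDyRamFourFramePieces (mstarOfRecord)
open Summit.HodgeConjecture.HodgeConjecture.Cruxes.H413.F0P3cDyRamDiagonalTorusDefs (normalisedStableLattices stabiliserWeight IsDualisableLattice)
open Summit.HodgeConjecture.HodgeConjecture.Cruxes.H413.F0P3cDyRamDiagonalKappaCountDefs (kappaCount)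
open Summit.HodgeConjecture.HodgeConjecture.Cruxes.H413.F0P3cDyRamOmegaRDefs (omegaR)
open Summit.HodgeConjecture.HodgeConjecture.Cruxes.H413.F0P3cDyRamKappaAssemblyTools (exists_glue_witness)
open Summit.HodgeConjecture.HodgeConjecture.Cruxes.H413.F0P3cDyRamDiagonalPermutation (isElementDatum_swap isElementDatum_rescale)
open Summit.HodgeConjecture.HodgeConjecture.Cruxes.H413.F0P3cDyRamElementDatumParity (isoceles_of_isElementDatum)
open Summit.HodgeConjecture.HodgeConjecture.Cruxes.H413.F0P3cDyRamDiagonalGlueSignDefs (IsGlueRep glueSign)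
open Summit.HodgeConjecture.HodgeConjecture.Cruxes.H413.F0P3cDyRamDiagonalGlueSignEval (ampl_eq_zero_of_nonpos)
open Summit.HodgeConjecture.HodgeConjecture.Cruxes.H413.F0P3cDyRamDiagonalGlueSignTokenRotations
open Summit.HodgeConjecture.HodgeConjecture.Cruxes.H413.F0P3cDyRamStableModelSumOfStageB
open Summit.HodgeConjecture.HodgeConjecture.Cruxes.H413.F0P3cDyRamLevelsKappaSignLawOfLabelledModelSum
open Summit.HodgeConjecture.HodgeConjecture.Cruxes.H413.F0P3cDyRamDiagonalKappaOrbitCountLabelled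
open Summit.HodgeConjecture.HodgeConjecture.Cruxes.H413.F0P3cDyRamStageOneBDefs
open Summit.HodgeConjecture.HodgeConjecture.Cruxes.H413.F0P3cDyRamStageOneBDerivedDefs
open Summit.HodgeConjecture.HodgeConjecture.Cruxes.H413.F0P3cDyRamLevKappaSignModelSumOfLabelledStageB
open scoped Valued WithZero Matrix MatrixGroups

/-! ## §1  (L2c) at a general threshold `N₀` -/

/-- **(L2c) AT THRESHOLD `N₀`** — ★ p858900 labelled κ-Stage A + the labelled signed κ-Stage B₀ with two tokens at element-datum threshold `N₀` (`hBκS0`, dualisable-set form — the ★ bridge inside) ⟹ the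
`hLKSS` binder of ★ p859535 `fencedLevelsKappaSignSlot_of_labelledModelSum shiftR Ω N₀ la lb A` for every `K` (★ p859645 `levKappaSignModelSum2_of_labelledKappaStageB` is the instance
`N₀ := depthOfRecord`; same body). [cite: Kottwitz1986BaseChangeUnits, §1 pp. 240–241] [cite: Rogawski1990, §4.9 Prop. 4.9.1 (a) p. 55] [cite: LanglandsShelstad1987, §1.3] -/
theorem levKappaSignModelSum2_at_of_labelledKappaStageB (Ω : OmegaSchedule) (N₀ la lb : ℕ → ℕ) (A : ℕ → ℕ → ℕ → ℕ → ℤ → ℚ)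
    (hBκS0 : ∀ {K : Type} [Field K] [Valued K ℤᵐ⁰] [CompleteSpace K] [Fintype 𝓀[K]] {σ : K →+* K} {ϖ : K} {d t : ℕ}, IsRamifiedQuadraticDatum σ ϖ d t →
      Valued.v (2 : K) < 1 → ∀ {δ : K}, σ δ = -δ → δ ≠ 0 →
      ∀ {a b : K}, a * σ a = 1 → b * σ b = 1 → Valued.v (a - 1) < Valued.v (2 : K) → Valued.v (b - 1) < Valued.v (2 : K) →
      ∀ {n₁ n₂ n₃ : ℕ}, IsElementDatum σ ϖ (N₀ d) (a * a) (b * b) n₁ n₂ n₃ →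
      ∀ (T : GL (Fin 3) K), (T : Matrix (Fin 3) (Fin 3) K) = Matrix.diagonal ![a * a, b * b, 1] → ∀ (k : ℕ), 2 * k + d = n₁ + n₂ + n₃ + 2 →
      ∀ (i : Fin 3) (B : ℤ), 2 * B = ((![n₁, n₂, n₃] : Fin 3 → ℕ) i : ℤ) - d + 2 - 2 * shiftR d t →
        ∑ᶠ M ∈ {M : Submodule 𝒪[K] (Fin 3 → K) | M ∈ normalisedStableLattices T ∧ IsDualisableLattice σ ϖ M ∧
            (LatticeInLevel ϖ (la d) (Matrix.diagonal ![a * a - 1, b * b - 1, 0]) M ∧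
              LatticeInLevel ϖ (lb d) (Matrix.diagonal ![(a * a - 1) * (a * a - 1), (b * b - 1) * (b * b - 1), 0]) M)},
            (kappaCount σ ϖ 0 i M : ℚ) * stabiliserWeight σ M =
          ((Ω K σ ϖ d a b i * ((![normSign σ (-1 : K), normSign σ (-1 : K), 1] : Fin 3 → ℤ) i *
            (baseSign σ i * normSign σ (fPartProd δ ![a, b, 1] i))) : ℤ) : ℚ) * A (Fintype.card 𝓀[K]) d t k B / 4)
    {K : Type} [Field K] [Valued K ℤᵐ⁰] [CompleteSpace K] [Fintype 𝓀[K]] (σ : K →+* K) (ϖ : K) (d t : ℕ) :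
    Valued.v (2 : K) < 1 → IsRamifiedQuadraticDatum σ ϖ d t →
      ∀ c : K, σ c = c → Valued.v c = 1 → (∀ x : K, σ x = x → x ≠ 0 → (∃ z : K, z * σ z = x) ∨ ∃ z : K, z * σ z = c * x) →
      ∀ (δ : K), σ δ = -δ → δ ≠ 0 →
      ∀ (a b : K), a * σ a = 1 → b * σ b = 1 → Valued.v (a - 1) < Valued.v (2 : K) → Valued.v (b - 1) < Valued.v (2 : K) →
      ∀ (n₁ n₂ n₃ : ℕ), IsElementDatum σ ϖ (N₀ d) (a * a) (b * b) n₁ n₂ n₃ →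
      ∀ (T : GL (Fin 3) K), (T : Matrix (Fin 3) (Fin 3) K) = Matrix.diagonal ![a * a, b * b, 1] →
      ∀ (k : ℕ), 2 * k + d = n₁ + n₂ + n₃ + 2 →
      ∀ (i : Fin 3) (B : ℤ), 2 * B = ((![n₁, n₂, n₃] : Fin 3 → ℕ) i : ℤ) - d + 2 - 2 * shiftR d t →
        ((∑ s : Fin 3 → Bool,
            (![(if s 1 then -1 else 1) * (if s 2 then -1 else 1),
               (if s 0 then -1 else 1) * (if s 2 then -1 else 1),
               (if s 0 then -1 else 1) * (if s 1 then -1 else 1)] : Fin 3 → ℤ) i *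
              ({M : Submodule 𝒪[K] (Fin 3 → K) |
                IsVertexLattice σ ϖ (Matrix.diagonal fun j => if s j then c else (1 : K)) 0 M ∧ mapGL T M = M ∧
                  (LatticeInLevel ϖ (la d) (Matrix.diagonal ![a * a - 1, b * b - 1, 0]) M ∧
                    LatticeInLevel ϖ (lb d) (Matrix.diagonal ![(a * a - 1) * (a * a - 1), (b * b - 1) * (b * b - 1), 0]) M)}.ncard : ℤ) : ℤ) : ℚ) =
          2 * ((Ω K σ ϖ d a b i * ((![normSign σ (-1 : K), normSign σ (-1 : K), 1] : Fin 3 → ℤ) i *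
            (baseSign σ i * normSign σ (fPartProd δ ![a, b, 1] i))) : ℤ) : ℚ) * A (Fintype.card 𝓀[K]) d t k B := by
  intro h2 hD c hσc hcv hdich δ hδ hδ0 a b ha hb ha2 hb2 n₁ n₂ n₃ hE T hT k hk i B hB
  have hσ : ∀ x, σ (σ x) = x := hD.1
  have hvσ : ∀ a, Valued.v (σ a) = Valued.v a := hD.2.1
  have hϖ : Valued.v ϖ = WithZero.exp (-1 : ℤ) := hD.2.2.1
  have hc : ¬ ∃ z : K, z * σ z = c := not_exists_mul_map_eq_of_dichotomy hD h2 hcv hdich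
  have hs := v_vecCons_eq_one_of_isElementDatum hvσ hE
  have hreg := vecCons_injective_of_isElementDatum hE
  have hϖ0 : ϖ ≠ 0 := (Valuation.ne_zero_iff _).1 (by rw [hϖ]; exact WithZero.exp_ne_zero)
  have h8 : ∀ (X S' A' : ℚ), X = S' * A' / 4 → 8 * X = 2 * S' * A' := fun X S' A' h => by rw [h]; ring
  rw [cast_sum_signChar_mul_ncard_levels_eq_eight_mul_finsum_kappaCount hσ hvσ hϖ (Units.mk0 ϖ hϖ0) rfl hσc hcv hc hdich hs hreg T hT 0 i (la d) (lb d) _ _,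
    finsum_mem_labelled_eq_finsum_mem_dualisable]
  exact h8 _ _ _ (hBκS0 hD h2 hδ hδ0 ha hb ha2 hb2 hE T hT k hk i B hB)

/-- **(L2b-κS at `N₀`) ⟹ `DyadicFence (LevKappaSignLawAtS2 shiftR Ω N₀ la lb kl bl σ ϖ d t)`** — ★ DEFS №5's Prop BY NAME at any threshold and schedules (amplitude letter
`fun q d _t k B => ampl q (k − kl d) (B − bl d)` = ★ №6 `amplShift kl bl`, δ-equal to the Prop's RHS). [cite: Rogawski1990, §4.9 Prop. 4.9.1 (a)(b) p. 55] [cite: LanglandsShelstad1987, §1.3, §3] -/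
theorem dyadicFence_levKappaSignLawAtS2_at_of_labelledKappaStageB (Ω : OmegaSchedule) (N₀ la lb kl bl : ℕ → ℕ)
    (hBκS0 : ∀ {K : Type} [Field K] [Valued K ℤᵐ⁰] [CompleteSpace K] [Fintype 𝓀[K]] {σ : K →+* K} {ϖ : K} {d t : ℕ}, IsRamifiedQuadraticDatum σ ϖ d t →
      Valued.v (2 : K) < 1 → ∀ {δ : K}, σ δ = -δ → δ ≠ 0 →
      ∀ {a b : K}, a * σ a = 1 → b * σ b = 1 → Valued.v (a - 1) < Valued.v (2 : K) → Valued.v (b - 1) < Valued.v (2 : K) →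
      ∀ {n₁ n₂ n₃ : ℕ}, IsElementDatum σ ϖ (N₀ d) (a * a) (b * b) n₁ n₂ n₃ →
      ∀ (T : GL (Fin 3) K), (T : Matrix (Fin 3) (Fin 3) K) = Matrix.diagonal ![a * a, b * b, 1] → ∀ (k : ℕ), 2 * k + d = n₁ + n₂ + n₃ + 2 →
      ∀ (i : Fin 3) (B : ℤ), 2 * B = ((![n₁, n₂, n₃] : Fin 3 → ℕ) i : ℤ) - d + 2 - 2 * shiftR d t →
        ∑ᶠ M ∈ {M : Submodule 𝒪[K] (Fin 3 → K) | M ∈ normalisedStableLattices T ∧ IsDualisableLattice σ ϖ M ∧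
            (LatticeInLevel ϖ (la d) (Matrix.diagonal ![a * a - 1, b * b - 1, 0]) M ∧
              LatticeInLevel ϖ (lb d) (Matrix.diagonal ![(a * a - 1) * (a * a - 1), (b * b - 1) * (b * b - 1), 0]) M)},
            (kappaCount σ ϖ 0 i M : ℚ) * stabiliserWeight σ M =
          ((Ω K σ ϖ d a b i * ((![normSign σ (-1 : K), normSign σ (-1 : K), 1] : Fin 3 → ℤ) i *
            (baseSign σ i * normSign σ (fPartProd δ ![a, b, 1] i))) : ℤ) : ℚ) * ampl (Fintype.card 𝓀[K]) (k - kl d) (B - bl d) / 4)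
    {K : Type} [Field K] [Valued K ℤᵐ⁰] [CompleteSpace K] [Fintype 𝓀[K]] (σ : K →+* K) (ϖ : K) (d t : ℕ) :
    DyadicFence (K := K) (LevKappaSignLawAtS2 shiftR Ω N₀ la lb kl bl σ ϖ d t) :=
  fencedLevelsKappaSignSlot_of_labelledModelSum shiftR Ω N₀ la lb (fun q d _t k B => ampl q (k - kl d) (B - bl d))
    (fun σ ϖ d t h2 hD c hσc hcv hdich δ hδ hδ0 a b ha hb ha2 hb2 n₁ n₂ n₃ hE T hT k hk i B hB =>
      levKappaSignModelSum2_at_of_labelledKappaStageB Ω N₀ la lb (fun q d _t k B => ampl q (k - kl d) (B - bl d)) hBκS0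
        σ ϖ d t h2 hD c hσc hcv hdich δ hδ hδ0 a b ha hb ha2 hb2 n₁ n₂ n₃ hE T hT k hk i B hB)
    σ ϖ d t

/-! ## §2  The two-token labelled signed κ-Stage B₀ modulo its labelled trunk, at threshold `N₀` (★ p857128's body; `d ≤ N₀ d` for the glue witnesses) -/

/-- **(L2b-κS) MODULO THE LABELLED TRUNK, TWO TOKENS, THRESHOLD `N₀`** (`hN₀ : d ≤ N₀ d` feeds ★ `exists_glue_witness`; otherwise ★ p859769 ∕ ★ p859650 ∕ ★ p857128 verbatim).
[cite: Kottwitz1986BaseChangeUnits, §1 pp. 240–241] [cite: Rogawski1990, §4.9 Prop. 4.9.1 (a) p. 55; §4.10 p. 58] [cite: LanglandsShelstad1987, §3] [cite: Serre1979, Ch. V §3 Prop. 5, Cor. 3] -/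
theorem kappaSignCount2_typeZero_sepTwo_at_of_labelledTrunk (N₀ : ℕ → ℕ) (hN₀ : ∀ d, d ≤ N₀ d) (la lb : ℕ → ℕ) (A : ℕ → ℕ → ℕ → ℕ → ℤ → ℚ)
    (hA0 : ∀ (q d t k : ℕ) {B : ℤ}, 1 ≤ q → B ≤ 0 → A q d t k B = 0)
    (hTrunk : ∀ {K : Type} [Field K] [Valued K ℤᵐ⁰] [CompleteSpace K] [Fintype 𝓀[K]] {σ : K →+* K} {ϖ : K} {d t : ℕ}, IsRamifiedQuadraticDatum σ ϖ d t →
      Valued.v (2 : K) < 1 → ∀ {α β : K} {n₁ n₂ n₃ : ℕ}, IsElementDatum σ ϖ (N₀ d) α β n₁ n₂ n₃ →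
      ∀ (T : GL (Fin 3) K), (T : Matrix (Fin 3) (Fin 3) K) = Matrix.diagonal ![α, β, 1] → ∀ (k : ℕ), 2 * k + d = n₁ + n₂ + n₃ + 2 →
      ∀ (i : Fin 3) (B : ℤ), 2 * B = ((![n₁, n₂, n₃] : Fin 3 → ℕ) i : ℤ) - d + 2 - 2 * shiftR d t →
      ∀ {f₀ f₁ f₂ : K}, σ f₀ = f₀ → σ f₁ = f₁ → σ f₂ = f₂ →
      (n₂ = n₃ → n₂ ≤ n₁ → Valued.v (f₀ + (β - 1) / (α - 1)) ≤ Valued.v ϖ ^ (n₁ - d + 1)) →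
      (n₁ = n₃ → n₁ ≤ n₂ → Valued.v (f₁ + (α - 1) / (β - 1)) ≤ Valued.v ϖ ^ (n₂ - d + 1)) →
      (n₂ = n₁ → n₂ ≤ n₃ → Valued.v (f₂ + (β * α⁻¹ - 1) / (α⁻¹ - 1)) ≤ Valued.v ϖ ^ (n₃ - d + 1)) →
        ∑ᶠ M ∈ {M : Submodule 𝒪[K] (Fin 3 → K) | M ∈ normalisedStableLattices T ∧ IsDualisableLattice σ ϖ M ∧
            (LatticeInLevel ϖ (la d) (Matrix.diagonal ![α - 1, β - 1, 0]) M ∧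
              LatticeInLevel ϖ (lb d) (Matrix.diagonal ![(α - 1) * (α - 1), (β - 1) * (β - 1), 0]) M)},
            (kappaCount σ ϖ 0 i M : ℚ) * stabiliserWeight σ M =
          (if n₁ = n₂ ∧ n₂ = n₃ then ((((![normSign σ (-(1 + f₀)), normSign σ f₀ * normSign σ (-(1 + f₀)), normSign σ f₀] : Fin 3 → ℤ) i : ℤ) : ℚ))
          else if n₂ = n₃ then (![![(normSign σ (-1 : K) : ℚ) * normSign σ (1 + f₀), (normSign σ (-1 : K) : ℚ) * normSign σ f₀ * normSign σ (1 + f₀), (normSign σ f₀ : ℚ)],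
             ![(normSign σ (-1 : K) : ℚ) * normSign σ f₁ * normSign σ (1 + f₁), (normSign σ (-1 : K) : ℚ) * normSign σ (1 + f₁), (normSign σ f₁ : ℚ)],
             ![(normSign σ f₂ : ℚ), (normSign σ (-1 : K) : ℚ) * normSign σ f₂ * normSign σ (1 + f₂), (normSign σ (-1 : K) : ℚ) * normSign σ (1 + f₂)]] : Fin 3 → Fin 3 → ℚ) 0 i
          else if n₁ = n₃ then (![![(normSign σ (-1 : K) : ℚ) * normSign σ (1 + f₀), (normSign σ (-1 : K) : ℚ) * normSign σ f₀ * normSign σ (1 + f₀), (normSign σ f₀ : ℚ)],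
             ![(normSign σ (-1 : K) : ℚ) * normSign σ f₁ * normSign σ (1 + f₁), (normSign σ (-1 : K) : ℚ) * normSign σ (1 + f₁), (normSign σ f₁ : ℚ)],
             ![(normSign σ f₂ : ℚ), (normSign σ (-1 : K) : ℚ) * normSign σ f₂ * normSign σ (1 + f₂), (normSign σ (-1 : K) : ℚ) * normSign σ (1 + f₂)]] : Fin 3 → Fin 3 → ℚ) 1 i
          else (![![(normSign σ (-1 : K) : ℚ) * normSign σ (1 + f₀), (normSign σ (-1 : K) : ℚ) * normSign σ f₀ * normSign σ (1 + f₀), (normSign σ f₀ : ℚ)],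
             ![(normSign σ (-1 : K) : ℚ) * normSign σ f₁ * normSign σ (1 + f₁), (normSign σ (-1 : K) : ℚ) * normSign σ (1 + f₁), (normSign σ f₁ : ℚ)],
             ![(normSign σ f₂ : ℚ), (normSign σ (-1 : K) : ℚ) * normSign σ f₂ * normSign σ (1 + f₂), (normSign σ (-1 : K) : ℚ) * normSign σ (1 + f₂)]] : Fin 3 → Fin 3 → ℚ) 2 i) *
            (A (Fintype.card 𝓀[K]) d t k B / 4)) :
    ∀ {K : Type} [Field K] [Valued K ℤᵐ⁰] [CompleteSpace K] [Fintype 𝓀[K]] {σ : K →+* K} {ϖ : K} {d t : ℕ}, IsRamifiedQuadraticDatum σ ϖ d t →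
      Valued.v (2 : K) < 1 → ∀ {δ : K}, σ δ = -δ → δ ≠ 0 →
      ∀ {a b : K}, a * σ a = 1 → b * σ b = 1 → Valued.v (a - 1) < Valued.v (2 : K) → Valued.v (b - 1) < Valued.v (2 : K) →
      ∀ {n₁ n₂ n₃ : ℕ}, IsElementDatum σ ϖ (N₀ d) (a * a) (b * b) n₁ n₂ n₃ →
      ∀ (T : GL (Fin 3) K), (T : Matrix (Fin 3) (Fin 3) K) = Matrix.diagonal ![a * a, b * b, 1] → ∀ (k : ℕ), 2 * k + d = n₁ + n₂ + n₃ + 2 →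
      ∀ (i : Fin 3) (B : ℤ), 2 * B = ((![n₁, n₂, n₃] : Fin 3 → ℕ) i : ℤ) - d + 2 - 2 * shiftR d t →
        ∑ᶠ M ∈ {M : Submodule 𝒪[K] (Fin 3 → K) | M ∈ normalisedStableLattices T ∧ IsDualisableLattice σ ϖ M ∧
            (LatticeInLevel ϖ (la d) (Matrix.diagonal ![a * a - 1, b * b - 1, 0]) M ∧
              LatticeInLevel ϖ (lb d) (Matrix.diagonal ![(a * a - 1) * (a * a - 1), (b * b - 1) * (b * b - 1), 0]) M)},
            (kappaCount σ ϖ 0 i M : ℚ) * stabiliserWeight σ M =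
          ((omegaR K σ ϖ d a b i * ((![normSign σ (-1 : K), normSign σ (-1 : K), 1] : Fin 3 → ℤ) i *
            (baseSign σ i * normSign σ (fPartProd δ ![a, b, 1] i))) : ℤ) : ℚ) * A (Fintype.card 𝓀[K]) d t k B / 4 := by
  intro K _ _ _ _ σ ϖ d t hD h2 δ hδ hδ0 a b ha hb _ _ n₁ n₂ n₃ hE T hT k hk i B hB
  obtain ⟨-, hvσ, -, -, -, hd1, -⟩ := id hD
  have hN₀ : d ≤ N₀ d := hN₀ d
  obtain ⟨-, -, -, -, -, h₁, h₂, h₃, -, -, -⟩ := id hE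
  -- (1) the three glue witnesses (foot 0 ∕ H corner, the swapped foot, the rescaled foot)
  obtain ⟨f₀, hσf₀, hf₀⟩ := exists_glue_witness hD hE hN₀
  obtain ⟨f₁, hσf₁, hf₁⟩ := exists_glue_witness hD (isElementDatum_swap hE) hN₀
  obtain ⟨f₂, hσf₂, hf₂⟩ := exists_glue_witness hD (isElementDatum_rescale hvσ hE) hN₀
  -- (2) the LABELLED trunk (hypothesis): the labelled sum IS the witness token times the labelled amplitude
  rw [hTrunk hD h2 hE T hT k hk i B hB hσf₀ hσf₁ hσf₂ hf₀ hf₁ hf₂]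
  by_cases hB1 : 1 ≤ B
  · -- (4) ALIVE axis: the witness token is the law token
    have hshift : shiftR d t = ((d - d % 2 : ℕ) : ℤ) := rfl
    rw [hshift] at hB
    have hiso := isoceles_of_isElementDatum hD hE
    have htok :
        (if n₁ = n₂ ∧ n₂ = n₃ then ((((![normSign σ (-(1 + f₀)), normSign σ f₀ * normSign σ (-(1 + f₀)), normSign σ f₀] : Fin 3 → ℤ) i : ℤ) : ℚ))
        else if n₂ = n₃ then (![![(normSign σ (-1 : K) : ℚ) * normSign σ (1 + f₀), (normSign σ (-1 : K) : ℚ) * normSign σ f₀ * normSign σ (1 + f₀), (normSign σ f₀ : ℚ)],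
           ![(normSign σ (-1 : K) : ℚ) * normSign σ f₁ * normSign σ (1 + f₁), (normSign σ (-1 : K) : ℚ) * normSign σ (1 + f₁), (normSign σ f₁ : ℚ)],
           ![(normSign σ f₂ : ℚ), (normSign σ (-1 : K) : ℚ) * normSign σ f₂ * normSign σ (1 + f₂), (normSign σ (-1 : K) : ℚ) * normSign σ (1 + f₂)]] : Fin 3 → Fin 3 → ℚ) 0 i
        else if n₁ = n₃ then (![![(normSign σ (-1 : K) : ℚ) * normSign σ (1 + f₀), (normSign σ (-1 : K) : ℚ) * normSign σ f₀ * normSign σ (1 + f₀), (normSign σ f₀ : ℚ)],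
           ![(normSign σ (-1 : K) : ℚ) * normSign σ f₁ * normSign σ (1 + f₁), (normSign σ (-1 : K) : ℚ) * normSign σ (1 + f₁), (normSign σ f₁ : ℚ)],
           ![(normSign σ f₂ : ℚ), (normSign σ (-1 : K) : ℚ) * normSign σ f₂ * normSign σ (1 + f₂), (normSign σ (-1 : K) : ℚ) * normSign σ (1 + f₂)]] : Fin 3 → Fin 3 → ℚ) 1 i
        else (![![(normSign σ (-1 : K) : ℚ) * normSign σ (1 + f₀), (normSign σ (-1 : K) : ℚ) * normSign σ f₀ * normSign σ (1 + f₀), (normSign σ f₀ : ℚ)],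
           ![(normSign σ (-1 : K) : ℚ) * normSign σ f₁ * normSign σ (1 + f₁), (normSign σ (-1 : K) : ℚ) * normSign σ (1 + f₁), (normSign σ f₁ : ℚ)],
           ![(normSign σ f₂ : ℚ), (normSign σ (-1 : K) : ℚ) * normSign σ f₂ * normSign σ (1 + f₂), (normSign σ (-1 : K) : ℚ) * normSign σ (1 + f₂)]] : Fin 3 → Fin 3 → ℚ) 2 i) =
          ((omegaR K σ ϖ d a b i * ((![normSign σ (-1 : K), normSign σ (-1 : K), 1] : Fin 3 → ℤ) i *
            (baseSign σ i * normSign σ (fPartProd δ ![a, b, 1] i))) : ℤ) : ℚ) := by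
      by_cases h123 : n₁ = n₂ ∧ n₂ = n₃
      · -- the H corner: all three depths equal `n₁`
        rw [if_pos h123]
        obtain ⟨h12, h23⟩ := h123
        have h₂' : Valued.v (a * a - 1) = Valued.v ϖ ^ n₁ := by rw [h12]; exact h₂
        have h₃' : Valued.v (a * a - b * b) = Valued.v ϖ ^ n₁ := by rw [h12, h23]; exact h₃
        have hni : (((![n₁, n₂, n₃] : Fin 3 → ℕ) i : ℕ) : ℤ) = n₁ := by fin_cases i <;> simp [h12, h23]
        rw [hni] at hB
        exact hCorner_slot hD hδ hδ0 ha hb h₁ h₂' h₃' hσf₀ (hf₀ h23 (by omega)) (by omega) i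
      · rw [if_neg h123]
        by_cases h23 : n₂ = n₃
        · -- foot 0: `n₂ = n₃ < n₁`
          rw [if_pos h23]
          have h21 : n₂ ≤ n₁ := by omega
          fin_cases i
          · simp only [Fin.zero_eta, Fin.isValue, Matrix.cons_val_zero] at hB ⊢
            exact footZero_slot_zero hD hδ hδ0 ha hb h₁ h₂ h₃ h23 hσf₀ (hf₀ h23 h21) (by omega)
          · simp only [Fin.mk_one, Fin.isValue, Matrix.cons_val_one, Matrix.cons_val_zero] at hB ⊢
            exact footZero_slot_one hD hδ hδ0 ha hb h₁ h₂ h₃ h23 h21 hσf₀ (hf₀ h23 h21) (by omega)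
          · simp only [Fin.reduceFinMk, Fin.isValue, Matrix.cons_val_two, Matrix.cons_val_zero, Matrix.tail_cons, Matrix.head_cons] at hB ⊢
            exact footZero_slot_two hD hδ hδ0 ha hb h₁ h₂ h₃ h21 hσf₀ (hf₀ h23 h21) (by omega)
        · rw [if_neg h23]
          by_cases h13 : n₁ = n₃
          · -- foot 1: `n₁ = n₃ < n₂`, the swapped datum `(b, a)`
            rw [if_pos h13]
            have h12 : n₁ ≤ n₂ := by omega
            fin_cases i
            · simp only [Fin.zero_eta, Fin.isValue, Matrix.cons_val_zero, Matrix.cons_val_one] at hB ⊢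
              exact footOne_slot_zero hD hδ hδ0 ha hb h₁ h₂ h₃ h13 h12 hσf₁ (hf₁ h13 h12) (by omega)
            · simp only [Fin.mk_one, Fin.isValue, Matrix.cons_val_one, Matrix.cons_val_zero] at hB ⊢
              exact footOne_slot_one hD hδ hδ0 ha hb h₁ h₂ h₃ h13 hσf₁ (hf₁ h13 h12) (by omega)
            · simp only [Fin.reduceFinMk, Fin.isValue, Matrix.cons_val_two, Matrix.cons_val_one, Matrix.cons_val_zero, Matrix.tail_cons, Matrix.head_cons] at hB ⊢
              exact footOne_slot_two hD hδ hδ0 ha hb h₁ h₂ h₃ h12 hσf₁ (hf₁ h13 h12) (by omega)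
          · -- foot 2: `n₁ = n₂ < n₃`, the rescaled datum `(a⁻¹, b·a⁻¹)`
            rw [if_neg h13]
            have h12 : n₁ = n₂ := by omega
            have h23' : n₂ ≤ n₃ := by omega
            fin_cases i
            · simp only [Fin.zero_eta, Fin.isValue, Matrix.cons_val_zero, Matrix.cons_val_two, Matrix.tail_cons, Matrix.head_cons] at hB ⊢
              exact footTwo_slot_zero hD hδ hδ0 ha hb h₁ h₂ h₃ h23' hσf₂ (hf₂ h12.symm h23') (by omega)
            · simp only [Fin.mk_one, Fin.isValue, Matrix.cons_val_one, Matrix.cons_val_two, Matrix.cons_val_zero, Matrix.tail_cons, Matrix.head_cons] at hB ⊢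
              exact footTwo_slot_one hD hδ hδ0 ha hb h₁ h₂ h₃ h12 h23' hσf₂ (hf₂ h12.symm h23') (by omega)
            · simp only [Fin.reduceFinMk, Fin.isValue, Matrix.cons_val_two, Matrix.tail_cons, Matrix.head_cons] at hB ⊢
              exact footTwo_slot_two hD hδ hδ0 ha hb h₁ h₂ h₃ h12 hσf₂ (hf₂ h12.symm h23') (by omega)
    rw [htok, mul_div_assoc]
  · -- (3) DEAD axis: the amplitude vanishes on both sides
    have hB0 : B ≤ 0 := by omega
    rw [hA0 _ d t k (Fintype.card_pos_iff.2 ⟨0⟩) hB0, zero_div, mul_zero, mul_zero, zero_div]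

/-- `ampl q (k − ks) (B − bs) = 0` for `B ≤ 0`, `1 ≤ q` (the dead-axis vanishing `hA0` of every shifted amplitude letter; ★ `ampl_eq_zero_of_nonpos`, `B − bs ≤ 0`).
[cite: Rogawski1990, §4.9 Prop. 4.9.1 (a) p. 55] -/
theorem ampl_shift_eq_zero_of_nonpos (kl bl : ℕ → ℕ) (q d k : ℕ) {B : ℤ} (hq : 1 ≤ q) (hB : B ≤ 0) :
    ampl q (k - kl d) (B - bl d) = 0 :=
  ampl_eq_zero_of_nonpos hq (k - kl d) (by omega)

/-! ## §3  ENDs BY NAME: the generic head and the two ED. 6 clean-level stub statements modulo their labelled trunks -/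

/-- **`DyadicFence (LevKappaSignLawAtS2 shiftR omegaR N₀ la lb kl bl σ ϖ d t)` MODULO THE TWO-TOKEN LABELLED TRUNK at threshold `N₀ ≥ d`** (§2′ ∘ §1).
[cite: Kottwitz1986BaseChangeUnits, §1 pp. 240–241] [cite: Rogawski1990, §4.9 Prop. 4.9.1 (a)(b) p. 55] [cite: LanglandsShelstad1987, §1.3, §3] -/
theorem dyadicFence_levKappaSignLawAtS2_at_of_labelledTrunk (N₀ : ℕ → ℕ) (hN₀ : ∀ d, d ≤ N₀ d) (la lb kl bl : ℕ → ℕ)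
    (hTrunk : ∀ {K : Type} [Field K] [Valued K ℤᵐ⁰] [CompleteSpace K] [Fintype 𝓀[K]] {σ : K →+* K} {ϖ : K} {d t : ℕ}, IsRamifiedQuadraticDatum σ ϖ d t →
      Valued.v (2 : K) < 1 → ∀ {α β : K} {n₁ n₂ n₃ : ℕ}, IsElementDatum σ ϖ (N₀ d) α β n₁ n₂ n₃ →
      ∀ (T : GL (Fin 3) K), (T : Matrix (Fin 3) (Fin 3) K) = Matrix.diagonal ![α, β, 1] → ∀ (k : ℕ), 2 * k + d = n₁ + n₂ + n₃ + 2 →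
      ∀ (i : Fin 3) (B : ℤ), 2 * B = ((![n₁, n₂, n₃] : Fin 3 → ℕ) i : ℤ) - d + 2 - 2 * shiftR d t →
      ∀ {f₀ f₁ f₂ : K}, σ f₀ = f₀ → σ f₁ = f₁ → σ f₂ = f₂ →
      (n₂ = n₃ → n₂ ≤ n₁ → Valued.v (f₀ + (β - 1) / (α - 1)) ≤ Valued.v ϖ ^ (n₁ - d + 1)) →
      (n₁ = n₃ → n₁ ≤ n₂ → Valued.v (f₁ + (α - 1) / (β - 1)) ≤ Valued.v ϖ ^ (n₂ - d + 1)) →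
      (n₂ = n₁ → n₂ ≤ n₃ → Valued.v (f₂ + (β * α⁻¹ - 1) / (α⁻¹ - 1)) ≤ Valued.v ϖ ^ (n₃ - d + 1)) →
        ∑ᶠ M ∈ {M : Submodule 𝒪[K] (Fin 3 → K) | M ∈ normalisedStableLattices T ∧ IsDualisableLattice σ ϖ M ∧
            (LatticeInLevel ϖ (la d) (Matrix.diagonal ![α - 1, β - 1, 0]) M ∧
              LatticeInLevel ϖ (lb d) (Matrix.diagonal ![(α - 1) * (α - 1), (β - 1) * (β - 1), 0]) M)},
            (kappaCount σ ϖ 0 i M : ℚ) * stabiliserWeight σ M =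
          (if n₁ = n₂ ∧ n₂ = n₃ then ((((![normSign σ (-(1 + f₀)), normSign σ f₀ * normSign σ (-(1 + f₀)), normSign σ f₀] : Fin 3 → ℤ) i : ℤ) : ℚ))
          else if n₂ = n₃ then (![![(normSign σ (-1 : K) : ℚ) * normSign σ (1 + f₀), (normSign σ (-1 : K) : ℚ) * normSign σ f₀ * normSign σ (1 + f₀), (normSign σ f₀ : ℚ)],
             ![(normSign σ (-1 : K) : ℚ) * normSign σ f₁ * normSign σ (1 + f₁), (normSign σ (-1 : K) : ℚ) * normSign σ (1 + f₁), (normSign σ f₁ : ℚ)],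
             ![(normSign σ f₂ : ℚ), (normSign σ (-1 : K) : ℚ) * normSign σ f₂ * normSign σ (1 + f₂), (normSign σ (-1 : K) : ℚ) * normSign σ (1 + f₂)]] : Fin 3 → Fin 3 → ℚ) 0 i
          else if n₁ = n₃ then (![![(normSign σ (-1 : K) : ℚ) * normSign σ (1 + f₀), (normSign σ (-1 : K) : ℚ) * normSign σ f₀ * normSign σ (1 + f₀), (normSign σ f₀ : ℚ)],
             ![(normSign σ (-1 : K) : ℚ) * normSign σ f₁ * normSign σ (1 + f₁), (normSign σ (-1 : K) : ℚ) * normSign σ (1 + f₁), (normSign σ f₁ : ℚ)],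
             ![(normSign σ f₂ : ℚ), (normSign σ (-1 : K) : ℚ) * normSign σ f₂ * normSign σ (1 + f₂), (normSign σ (-1 : K) : ℚ) * normSign σ (1 + f₂)]] : Fin 3 → Fin 3 → ℚ) 1 i
          else (![![(normSign σ (-1 : K) : ℚ) * normSign σ (1 + f₀), (normSign σ (-1 : K) : ℚ) * normSign σ f₀ * normSign σ (1 + f₀), (normSign σ f₀ : ℚ)],
             ![(normSign σ (-1 : K) : ℚ) * normSign σ f₁ * normSign σ (1 + f₁), (normSign σ (-1 : K) : ℚ) * normSign σ (1 + f₁), (normSign σ f₁ : ℚ)],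
             ![(normSign σ f₂ : ℚ), (normSign σ (-1 : K) : ℚ) * normSign σ f₂ * normSign σ (1 + f₂), (normSign σ (-1 : K) : ℚ) * normSign σ (1 + f₂)]] : Fin 3 → Fin 3 → ℚ) 2 i) *
            (ampl (Fintype.card 𝓀[K]) (k - kl d) (B - bl d) / 4))
    {K : Type} [Field K] [Valued K ℤᵐ⁰] [CompleteSpace K] [Fintype 𝓀[K]] (σ : K →+* K) (ϖ : K) (d t : ℕ) :
    DyadicFence (K := K) (LevKappaSignLawAtS2 shiftR omegaR N₀ la lb kl bl σ ϖ d t) :=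
  dyadicFence_levKappaSignLawAtS2_at_of_labelledKappaStageB omegaR N₀ la lb kl bl
    (kappaSignCount2_typeZero_sepTwo_at_of_labelledTrunk N₀ hN₀ la lb (fun q d _t k B => ampl q (k - kl d) (B - bl d))
      (fun q d _t k _B hq hB => ampl_shift_eq_zero_of_nonpos kl bl q d k hq hB) hTrunk) σ ϖ d t

/-- `d ≤ n0DerivedOfRecord d` (`mcOfRecord d = 2·((m* + d)∕2) ≥ 2d ≥ d`, ★ №6 `mcOfRecord_le_n0DerivedOfRecord`). [cite: Rogawski1990, §4.9 Prop. 4.9.1 (a) p. 55] -/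
theorem le_n0DerivedOfRecord (d : ℕ) : d ≤ n0DerivedOfRecord d := by
  refine le_trans ?_ (mcOfRecord_le_n0DerivedOfRecord d)
  unfold mcOfRecord mstarOfRecord
  omega

/-- **`stub_law_levCleanLo` MODULO ITS LABELLED TRUNK** (tier-0 ED. 6, dealer WORD #62): `DyadicFence (LevKappaSignLawAtS2 shiftR omegaR n0DerivedOfRecord laLowOfRecord mcOfRecord
sTOfRecord sTOfRecord σ ϖ d t)` BY NAME from the two-token labelled trunk at `(N₀, la, lb, A) := (n0DerivedOfRecord, laLowOfRecord, mcOfRecord, amplShift sTOfRecord sTOfRecord)`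
(target (T4) of (r6) SIG-L-lev v4; fit `mc_check` R-U 16∕16, R-P 8∕8 above `n0CleanOfRecord`). [cite: Rogawski1990, §4.9 Prop. 4.9.1 (a)(b) p. 55] [cite: LanglandsShelstad1987, §1.3, §3] -/
theorem dyadicFence_levKappaSignLawAtS2_cleanLow_ofRecord_of_labelledTrunk
    (hTrunkCLo : ∀ {K : Type} [Field K] [Valued K ℤᵐ⁰] [CompleteSpace K] [Fintype 𝓀[K]] {σ : K →+* K} {ϖ : K} {d t : ℕ}, IsRamifiedQuadraticDatum σ ϖ d t →
      Valued.v (2 : K) < 1 → ∀ {α β : K} {n₁ n₂ n₃ : ℕ}, IsElementDatum σ ϖ (n0DerivedOfRecord d) α β n₁ n₂ n₃ →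
      ∀ (T : GL (Fin 3) K), (T : Matrix (Fin 3) (Fin 3) K) = Matrix.diagonal ![α, β, 1] → ∀ (k : ℕ), 2 * k + d = n₁ + n₂ + n₃ + 2 →
      ∀ (i : Fin 3) (B : ℤ), 2 * B = ((![n₁, n₂, n₃] : Fin 3 → ℕ) i : ℤ) - d + 2 - 2 * shiftR d t →
      ∀ {f₀ f₁ f₂ : K}, σ f₀ = f₀ → σ f₁ = f₁ → σ f₂ = f₂ →
      (n₂ = n₃ → n₂ ≤ n₁ → Valued.v (f₀ + (β - 1) / (α - 1)) ≤ Valued.v ϖ ^ (n₁ - d + 1)) →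
      (n₁ = n₃ → n₁ ≤ n₂ → Valued.v (f₁ + (α - 1) / (β - 1)) ≤ Valued.v ϖ ^ (n₂ - d + 1)) →
      (n₂ = n₁ → n₂ ≤ n₃ → Valued.v (f₂ + (β * α⁻¹ - 1) / (α⁻¹ - 1)) ≤ Valued.v ϖ ^ (n₃ - d + 1)) →
        ∑ᶠ M ∈ {M : Submodule 𝒪[K] (Fin 3 → K) | M ∈ normalisedStableLattices T ∧ IsDualisableLattice σ ϖ M ∧
            (LatticeInLevel ϖ (laLowOfRecord d) (Matrix.diagonal ![α - 1, β - 1, 0]) M ∧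
              LatticeInLevel ϖ (mcOfRecord d) (Matrix.diagonal ![(α - 1) * (α - 1), (β - 1) * (β - 1), 0]) M)},
            (kappaCount σ ϖ 0 i M : ℚ) * stabiliserWeight σ M =
          (if n₁ = n₂ ∧ n₂ = n₃ then ((((![normSign σ (-(1 + f₀)), normSign σ f₀ * normSign σ (-(1 + f₀)), normSign σ f₀] : Fin 3 → ℤ) i : ℤ) : ℚ))
          else if n₂ = n₃ then (![![(normSign σ (-1 : K) : ℚ) * normSign σ (1 + f₀), (normSign σ (-1 : K) : ℚ) * normSign σ f₀ * normSign σ (1 + f₀), (normSign σ f₀ : ℚ)],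
             ![(normSign σ (-1 : K) : ℚ) * normSign σ f₁ * normSign σ (1 + f₁), (normSign σ (-1 : K) : ℚ) * normSign σ (1 + f₁), (normSign σ f₁ : ℚ)],
             ![(normSign σ f₂ : ℚ), (normSign σ (-1 : K) : ℚ) * normSign σ f₂ * normSign σ (1 + f₂), (normSign σ (-1 : K) : ℚ) * normSign σ (1 + f₂)]] : Fin 3 → Fin 3 → ℚ) 0 i
          else if n₁ = n₃ then (![![(normSign σ (-1 : K) : ℚ) * normSign σ (1 + f₀), (normSign σ (-1 : K) : ℚ) * normSign σ f₀ * normSign σ (1 + f₀), (normSign σ f₀ : ℚ)],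
             ![(normSign σ (-1 : K) : ℚ) * normSign σ f₁ * normSign σ (1 + f₁), (normSign σ (-1 : K) : ℚ) * normSign σ (1 + f₁), (normSign σ f₁ : ℚ)],
             ![(normSign σ f₂ : ℚ), (normSign σ (-1 : K) : ℚ) * normSign σ f₂ * normSign σ (1 + f₂), (normSign σ (-1 : K) : ℚ) * normSign σ (1 + f₂)]] : Fin 3 → Fin 3 → ℚ) 1 i
          else (![![(normSign σ (-1 : K) : ℚ) * normSign σ (1 + f₀), (normSign σ (-1 : K) : ℚ) * normSign σ f₀ * normSign σ (1 + f₀), (normSign σ f₀ : ℚ)],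
             ![(normSign σ (-1 : K) : ℚ) * normSign σ f₁ * normSign σ (1 + f₁), (normSign σ (-1 : K) : ℚ) * normSign σ (1 + f₁), (normSign σ f₁ : ℚ)],
             ![(normSign σ f₂ : ℚ), (normSign σ (-1 : K) : ℚ) * normSign σ f₂ * normSign σ (1 + f₂), (normSign σ (-1 : K) : ℚ) * normSign σ (1 + f₂)]] : Fin 3 → Fin 3 → ℚ) 2 i) *
            (ampl (Fintype.card 𝓀[K]) (k - sTOfRecord d) (B - sTOfRecord d) / 4))
    {K : Type} [Field K] [Valued K ℤᵐ⁰] [CompleteSpace K] [Fintype 𝓀[K]] (σ : K →+* K) (ϖ : K) (d t : ℕ) :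
    DyadicFence (K := K) (LevKappaSignLawAtS2 shiftR omegaR n0DerivedOfRecord laLowOfRecord mcOfRecord sTOfRecord sTOfRecord σ ϖ d t) :=
  dyadicFence_levKappaSignLawAtS2_at_of_labelledTrunk n0DerivedOfRecord le_n0DerivedOfRecord laLowOfRecord mcOfRecord sTOfRecord sTOfRecord hTrunkCLo σ ϖ d t

/-- **`stub_law_levCleanHi` MODULO ITS LABELLED TRUNK** (tier-0 ED. 6): `DyadicFence (LevKappaSignLawAtS2 shiftR omegaR n0DerivedOfRecord laHighOfRecord mcOfRecord (fun d => sTOfRecord d + 1)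
(fun d => sTOfRecord d − 1) σ ϖ d t)` BY NAME (target (T5); fit R-U 16∕16, R-P 13∕13). [cite: Rogawski1990, §4.9 Prop. 4.9.1 (a)(b) p. 55] [cite: LanglandsShelstad1987, §1.3, §3] -/
theorem dyadicFence_levKappaSignLawAtS2_cleanHigh_ofRecord_of_labelledTrunk
    (hTrunkCHi : ∀ {K : Type} [Field K] [Valued K ℤᵐ⁰] [CompleteSpace K] [Fintype 𝓀[K]] {σ : K →+* K} {ϖ : K} {d t : ℕ}, IsRamifiedQuadraticDatum σ ϖ d t →
      Valued.v (2 : K) < 1 → ∀ {α β : K} {n₁ n₂ n₃ : ℕ}, IsElementDatum σ ϖ (n0DerivedOfRecord d) α β n₁ n₂ n₃ →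
      ∀ (T : GL (Fin 3) K), (T : Matrix (Fin 3) (Fin 3) K) = Matrix.diagonal ![α, β, 1] → ∀ (k : ℕ), 2 * k + d = n₁ + n₂ + n₃ + 2 →
      ∀ (i : Fin 3) (B : ℤ), 2 * B = ((![n₁, n₂, n₃] : Fin 3 → ℕ) i : ℤ) - d + 2 - 2 * shiftR d t →
      ∀ {f₀ f₁ f₂ : K}, σ f₀ = f₀ → σ f₁ = f₁ → σ f₂ = f₂ →
      (n₂ = n₃ → n₂ ≤ n₁ → Valued.v (f₀ + (β - 1) / (α - 1)) ≤ Valued.v ϖ ^ (n₁ - d + 1)) →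
      (n₁ = n₃ → n₁ ≤ n₂ → Valued.v (f₁ + (α - 1) / (β - 1)) ≤ Valued.v ϖ ^ (n₂ - d + 1)) →
      (n₂ = n₁ → n₂ ≤ n₃ → Valued.v (f₂ + (β * α⁻¹ - 1) / (α⁻¹ - 1)) ≤ Valued.v ϖ ^ (n₃ - d + 1)) →
        ∑ᶠ M ∈ {M : Submodule 𝒪[K] (Fin 3 → K) | M ∈ normalisedStableLattices T ∧ IsDualisableLattice σ ϖ M ∧
            (LatticeInLevel ϖ (laHighOfRecord d) (Matrix.diagonal ![α - 1, β - 1, 0]) M ∧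
              LatticeInLevel ϖ (mcOfRecord d) (Matrix.diagonal ![(α - 1) * (α - 1), (β - 1) * (β - 1), 0]) M)},
            (kappaCount σ ϖ 0 i M : ℚ) * stabiliserWeight σ M =
          (if n₁ = n₂ ∧ n₂ = n₃ then ((((![normSign σ (-(1 + f₀)), normSign σ f₀ * normSign σ (-(1 + f₀)), normSign σ f₀] : Fin 3 → ℤ) i : ℤ) : ℚ))
          else if n₂ = n₃ then (![![(normSign σ (-1 : K) : ℚ) * normSign σ (1 + f₀), (normSign σ (-1 : K) : ℚ) * normSign σ f₀ * normSign σ (1 + f₀), (normSign σ f₀ : ℚ)],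
             ![(normSign σ (-1 : K) : ℚ) * normSign σ f₁ * normSign σ (1 + f₁), (normSign σ (-1 : K) : ℚ) * normSign σ (1 + f₁), (normSign σ f₁ : ℚ)],
             ![(normSign σ f₂ : ℚ), (normSign σ (-1 : K) : ℚ) * normSign σ f₂ * normSign σ (1 + f₂), (normSign σ (-1 : K) : ℚ) * normSign σ (1 + f₂)]] : Fin 3 → Fin 3 → ℚ) 0 i
          else if n₁ = n₃ then (![![(normSign σ (-1 : K) : ℚ) * normSign σ (1 + f₀), (normSign σ (-1 : K) : ℚ) * normSign σ f₀ * normSign σ (1 + f₀), (normSign σ f₀ : ℚ)],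
             ![(normSign σ (-1 : K) : ℚ) * normSign σ f₁ * normSign σ (1 + f₁), (normSign σ (-1 : K) : ℚ) * normSign σ (1 + f₁), (normSign σ f₁ : ℚ)],
             ![(normSign σ f₂ : ℚ), (normSign σ (-1 : K) : ℚ) * normSign σ f₂ * normSign σ (1 + f₂), (normSign σ (-1 : K) : ℚ) * normSign σ (1 + f₂)]] : Fin 3 → Fin 3 → ℚ) 1 i
          else (![![(normSign σ (-1 : K) : ℚ) * normSign σ (1 + f₀), (normSign σ (-1 : K) : ℚ) * normSign σ f₀ * normSign σ (1 + f₀), (normSign σ f₀ : ℚ)],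
             ![(normSign σ (-1 : K) : ℚ) * normSign σ f₁ * normSign σ (1 + f₁), (normSign σ (-1 : K) : ℚ) * normSign σ (1 + f₁), (normSign σ f₁ : ℚ)],
             ![(normSign σ f₂ : ℚ), (normSign σ (-1 : K) : ℚ) * normSign σ f₂ * normSign σ (1 + f₂), (normSign σ (-1 : K) : ℚ) * normSign σ (1 + f₂)]] : Fin 3 → Fin 3 → ℚ) 2 i) *
            (ampl (Fintype.card 𝓀[K]) (k - (sTOfRecord d + 1)) (B - ((sTOfRecord d - 1 : ℕ) : ℤ)) / 4))
    {K : Type} [Field K] [Valued K ℤᵐ⁰] [CompleteSpace K] [Fintype 𝓀[K]] (σ : K →+* K) (ϖ : K) (d t : ℕ) :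
    DyadicFence (K := K) (LevKappaSignLawAtS2 shiftR omegaR n0DerivedOfRecord laHighOfRecord mcOfRecord (fun d => sTOfRecord d + 1) (fun d => sTOfRecord d - 1) σ ϖ d t) :=
  dyadicFence_levKappaSignLawAtS2_at_of_labelledTrunk n0DerivedOfRecord le_n0DerivedOfRecord laHighOfRecord mcOfRecord (fun d => sTOfRecord d + 1) (fun d => sTOfRecord d - 1)
    hTrunkCHi σ ϖ d t

end Summit.HodgeConjecture.HodgeConjecture.Cruxes.H413.F0P3cDyRamLevKappaSignLawAtDepthOfLabelledTrunk

end
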